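import Literature.Geometry.Kaehler.ComplexTorusNeronSeveriPrimitiveLatticeDefinite
import Literature.Geometry.Kaehler.ComplexTorusLefschetzFormPrimitiveLattice
import Literature.Geometry.Kaehler.ComplexTorusIntegralHodgeLatticeTopMinimalClassSplitting
import Literature.Geometry.Kaehler.ComplexTorusMinimalClassesUnimodular
import HarnessLib

/-!
# The index of the Lefschetz splitting of the Néron–Severi lattice:
# `[NS(X) : ℤθ ⊕ NS(X)_prim] · [B₂(θ, H²(X, ℤ)) : B₂(θ, NS(X))] = g · d_g`

Layer `Literature/Geometry/Kaehler`, namespace `Literature.Geometry.Kaehler.ComplexTorus`; lane `lit-hodgefound`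
(Track 2 foundations library), seat p09, generation 48, rows g48-#7 (§1–§2) and g48-#8 (§3, same-seat append). THEOREMS ONLY (0 definitions); no named fact, net debt 0.
g44-#1 (`ComplexTorusNeronSeveriPrimitiveLatticeDefinite`) proved that `ℤθ ⊕ θ^⊥ ⊆ NS(X)` (`θ^⊥ = NS(X) ∩ P²(X, ℤ) = NS(X)_prim` for the Néron–Severi
lattice form `B_N(D, D') = ⟨D, γ_{g−2} ∧ D'⟩_e`) has finite index DIVIDING `|B_N(θ, θ)| = g(g−1)·d_{g−1}·d_g`, and g40 that in the whole lattice
`[H²(X, ℤ) : ℤθ ⊕ P²(X, ℤ)] = g·d_g`. Here the index is computed EXACTLY, by the method of g48-#5/#6 (`…TopMinimalClassSplitting`, `…ValueGroup`):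

* §1 **THE VALUE GROUP OF `θ` ON `H²(X, ℤ)` IS `(g−1)·d_{g−1}·ℤ`** (`IsPolarizationType.index_range_apply_polarization_eq`): `(j!·d₁⋯d_j)·⟨θ, γ_{g−2} ∧ y⟩ =
  ⟨θ^{∧(g−1)}, y⟩ = ((g−1)!·d₁⋯d_{g−1})·⟨γ_{g−1}, y⟩` (`content_mul_poincarePairing_ofRealForm_wedge_eq_poincarePairing_wedgePow`) and the minimal class
  `γ_{g−1}` (the class of a curve) is UNIMODULAR on `H²(X, ℤ)`.
* §2 **THE INDEX FORMULA `[NS(X) : ℤθ ⊕ θ^⊥] · n = g·d_g`**, `n = [B₂(θ, H²(X, ℤ)) : B_N(θ, NS(X))] ≥ 1` the index of the `θ`-degrees of divisor classes among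
  the `θ`-degrees of all integral `2`-classes (`IsPolarizationType.index_span_sup_orthogonal_neronSeveri_mul_relIndex_eq`): the line formula
  `[NS : ℤθ ⊕ θ^⊥]·[ℤ : B_N(θ, NS)] = |B_N(θ, θ)| = g(g−1)d_{g−1}d_g` (g48-#5 §0, g44-#1) divided by §1. COROLLARIES: `[NS(X) : ℤθ ⊕ θ^⊥] ∣ g·d_g`
  (g44-#1 had `∣ g(g−1)d_{g−1}d_g`); **`[NS(X) : ℤθ ⊕ θ^⊥] = g·d_g` iff every `θ`-degree of an integral `2`-class is the `θ`-degree of a divisor class**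
  (`n = 1`; e.g. `ρ(X) = b₂`); for a principal polarisation `[NS(X) : ℤθ ⊕ NS(X)_prim] · n = g` (`…_eq_of_forall_eq_one`; a very general p.p.a.v.: `NS = ℤθ`,
  index `1`, `n = g`; `E × E'` with the product polarisation: index `2 = g`, `n = 1`).
* §3 **THE DISCRIMINANT OF `NS(X)_prim`: `sign(e)·(−1)^g·(g−1)·d_{g−1}·n²·disc(θ^⊥) = g·d_g·disc NS(X)`** in any bases
  (`IsPolarizationType.relIndex_sq_mul_det_orthogonal_neronSeveri_eq`, absolute values `…natAbs_det_orthogonal_neronSeveri_mul_eq`): Huybrechts' (0.2) for the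
  line `ℤθ` (g44-#1: `B_N(θ,θ)·disc θ^⊥ = [NS : ℤθ ⊕ θ^⊥]²·disc NS`) with the exact index of §2; principal: `±(g−1)·n²·disc NS(X)_prim = g·disc NS(X)`.

## References

* [cite: Lange2023AbelianVarietiesComplex, §5.4.1 Thm. 5.4.2 and (5.22)–(5.23) (PDF p. 275); §2.5.3 Thm. 2.5.16, Cor. 2.5.17 (PDF p. 135); §1.7.2 Lemma 1.7.5 (PDF p. 73); §5.2 Thm. 5.2.4 (PDF p. 262); §6.2.4 (PDF p. 310)]
* [cite: Huybrechts2016K3, Ch. 14 §0.1–§0.2 (PDF p. 333)]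
* [cite: Hartshorne1977, Ch. V Thm. 1.9, Rem. 1.9.1]
* [cite: BenoistDebarre2023SmoothSubvarietiesJacobians, §1 (p. 3); §3 proof of Thm. 3.7 (p. 7)]
* [cite: Kitaoka1993, Ch. 5 Prop. 5.3.3 (proof)]
-/

noncomputable section

-- `Module ℂ` / `SMulZeroClass ℂ` synthesis on `E [⋀^Fin k]→L[ℝ] ℂ` (as in `ComplexTorusLefschetzDecomposition`)
set_option maxSynthPendingDepth 3

open Module Function Complex
open LinearMap (BilinForm)
open Literature.LinearAlgebra.Alternating

namespace Literature.Geometry.Kaehler.ComplexTorus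

/-! ## §1 The value group of `θ` on `H²(X, ℤ)`: `B₂(θ, H²(X, ℤ)) = (g−1)·d_{g−1}·ℤ` -/

section ValueGroup

variable {ι : Type*} [Fintype ι] [DecidableEq ι] {E : Type*} [NormedAddCommGroup E] [NormedSpace ℂ E]
  {Φ : (ι → ℝ) ≃L[ℝ] E} {j n : ℕ} {η : E [⋀^Fin 2]→L[ℝ] ℝ} {d : Fin (j + 2) → ℕ}

variable (Φ) in
omit [Fintype ι] in
/-- **`c · ⟨θ, γ ∧ y⟩_e = ⟨θ^{∧(j+1)}, y⟩_e`** whenever `θ^{∧j} = c·γ` (`θ = η_ℂ`, any `2`-form `y`): `⟨θ, γ ∧ y⟩ = ⟨y, γ ∧ θ⟩`, `c·(γ ∧ θ) = θ^{∧(j+1)}`, and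
`⟨y, θ^{∧(j+1)}⟩ = ⟨θ^{∧(j+1)}, y⟩` (even degrees commute). [cite: Lange2023AbelianVarietiesComplex, §6.2.4 (PDF p. 310); §7.3.2] [cite: VoisinHodgeI2002, §6.3.2] -/
theorem content_mul_poincarePairing_ofRealForm_wedge_eq_poincarePairing_wedgePow {γ : E [⋀^Fin (2 * j)]→L[ℝ] ℂ} {c : ℂ}
    (hγ : wedgePow (ofRealForm η) j = c • γ) (e : Fin n ≃ ι) (hn : 2 + (2 * j + 2) = n) (h' : 2 * (j + 1) + 2 = n) (y : E [⋀^Fin 2]→L[ℝ] ℂ) :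
    c * poincarePairing Φ e hn (ofRealForm η) (γ.wedge y) = poincarePairing Φ e h' (wedgePow (ofRealForm η) (j + 1)) y := by
  have hcw : c • γ.wedge (ofRealForm η : E [⋀^Fin 2]→L[ℝ] ℂ) = wedgePow (ofRealForm η) (j + 1) := by
    rw [← wedge_smul_left_complex, ← hγ]; rfl
  have h1 : c * poincarePairing Φ e hn (ofRealForm η) (γ.wedge y) = poincarePairing Φ e hn y (wedgePow (ofRealForm η) (j + 1)) := by
    rw [poincarePairing_wedge_comm_of_two Φ e hn γ (ofRealForm η) y, ← hcw, map_smul, smul_eq_mul]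
  rw [h1, poincarePairing_comm Φ e h' hn (wedgePow (ofRealForm η) (j + 1)) y, Even.neg_one_pow (even_two.mul_left _), one_mul]

omit [Fintype ι] [DecidableEq ι] in
/-- `∏_{i ≤ j+1} d_i = (∏_{i ≤ j} d_i) · d_{j+1}` along the initial-segment embeddings. [folklore] -/
private theorem prod_castLE_succ_eq₉₇ (d : Fin (j + 2) → ℕ) (hle : j ≤ j + 2) (h1le : j + 1 ≤ j + 2) :
    ∏ i : Fin (j + 1), d (Fin.castLE h1le i) = (∏ i : Fin j, d (Fin.castLE hle i)) * d (Fin.last j).castSucc := by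
  rw [Fin.prod_univ_castSucc]
  rfl

/-- **THE VALUE GROUP OF THE POLARISATION ON `H²(X, ℤ)`: `B₂(θ, H²(X, ℤ)) = (g−1)·d_{g−1}·ℤ`** (`g = j + 2`, `B₂ = ⟨·, γ_{g−2} ∧ ·⟩_e` the integral Lefschetz
form of degree two): `(j!·d₁⋯d_j)·B₂(θ, y) = ((j+1)!·d₁⋯d_{j+1})·⟨γ_{j+1}, y⟩_e` and the minimal (curve) class `γ_{g−1} = θ^{∧(g−1)}/((g−1)!·d₁⋯d_{g−1})` is
UNIMODULAR on `H²(X, ℤ)` (its values are all the integers). [cite: Lange2023AbelianVarietiesComplex, §2.5.3 Thm. 2.5.16, Cor. 2.5.17 (PDF p. 135); §5.2 Thm. 5.2.4 (PDF p. 262); §6.2.4 (PDF p. 310)] [cite: BenoistDebarre2023SmoothSubvarietiesJacobians, §1 (p. 3); §3 proof of Thm. 3.7 (p. 7)] -/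
theorem IsPolarizationType.index_range_apply_polarization_eq (hd : IsPolarizationType Φ η d) (hη : IsRiemannForm Φ η) (hle : j ≤ j + 2)
    {γ : E [⋀^Fin (2 * j)]→L[ℝ] ℂ} (hγ : wedgePow (ofRealForm η) j = ((j.factorial * ∏ i : Fin j, d (Fin.castLE hle i) : ℕ) : ℂ) • γ)
    (e : Fin n ≃ ι) (hn : 2 + (2 * j + 2) = n) {B : BilinForm ℤ ↥(integralForms Φ 2)}
    (hB : ∀ x y : ↥(integralForms Φ 2), ((B x y : ℤ) : ℂ) = poincarePairing Φ e hn (x : E [⋀^Fin 2]→L[ℝ] ℂ) (γ.wedge (y : E [⋀^Fin 2]→L[ℝ] ℂ)))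
    (θZ : ↥(integralForms Φ 2)) (hθZ : (θZ : E [⋀^Fin 2]→L[ℝ] ℂ) = ofRealForm η) :
    (LinearMap.range (B θZ)).toAddSubgroup.index = (j + 1) * d (Fin.last j).castSucc ∧
      (LinearMap.range (B θZ)).toAddSubgroup.index * (j.factorial * ∏ i : Fin j, d (Fin.castLE hle i)) =
        (j + 1).factorial * ∏ i : Fin (j + 1), d (Fin.castLE (Nat.le_succ (j + 1)) i) := by
  have h' : 2 * (j + 1) + 2 = n := by omega
  obtain ⟨γ', hγ'Z, hγ'⟩ := hd.exists_mem_integralForms_wedgePow_eq_content_smul (Nat.le_succ (j + 1))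
  -- the unimodular partner of the curve class `γ_{j+1}`
  obtain ⟨y₁, hy₁Z, hy₁⟩ := hd.exists_poincarePairing_eq_one_of_wedgePow_eq_content_smul hη (Nat.le_succ (j + 1)) hγ'Z hγ' e h'
  have hC0 : ((j.factorial * ∏ i : Fin j, d (Fin.castLE hle i) : ℕ) : ℤ) ≠ 0 := by
    exact_mod_cast (Nat.mul_pos (Nat.factorial_pos j) (Finset.prod_pos fun i _ ↦ hd.pos hη _)).ne'
  have key : ∀ y : ↥(integralForms Φ 2), ∃ c : ℤ, ((j.factorial * ∏ i : Fin j, d (Fin.castLE hle i) : ℕ) : ℤ) * B θZ y =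
      (((j + 1).factorial * ∏ i : Fin (j + 1), d (Fin.castLE (Nat.le_succ (j + 1)) i) : ℕ) : ℤ) * c ∧
      poincarePairing Φ e h' γ' (y : E [⋀^Fin 2]→L[ℝ] ℂ) = c := fun y ↦ by
    obtain ⟨c, hc⟩ := poincarePairing_mem_range_int Φ e h' hγ'Z y.2
    refine ⟨c, ?_, hc⟩
    apply Int.cast_injective (α := ℂ)
    have h := content_mul_poincarePairing_ofRealForm_wedge_eq_poincarePairing_wedgePow Φ hγ e hn h' (y : E [⋀^Fin 2]→L[ℝ] ℂ)
    rw [hγ', map_smul, LinearMap.smul_apply, smul_eq_mul, hc, ← hθZ, ← hB] at h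
    push_cast at h ⊢
    linear_combination h
  obtain ⟨c₁, hc₁, hc₁'⟩ := key ⟨y₁, hy₁Z⟩
  have hc₁1 : c₁ = 1 := by exact_mod_cast hc₁'.symm.trans hy₁
  rw [hc₁1, mul_one] at hc₁
  have hrange : (LinearMap.range (B θZ)).toAddSubgroup = AddSubgroup.zmultiples (B θZ ⟨y₁, hy₁Z⟩) := by
    refine le_antisymm (fun z hz ↦ ?_) (AddSubgroup.zmultiples_le_of_mem ⟨⟨y₁, hy₁Z⟩, rfl⟩)
    obtain ⟨y, rfl⟩ := LinearMap.mem_range.1 ((Submodule.mem_toAddSubgroup _).1 hz)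
    obtain ⟨c, hc, -⟩ := key y
    rw [← hc₁, mul_assoc _ (B θZ ⟨y₁, hy₁Z⟩) c] at hc
    refine AddSubgroup.mem_zmultiples_iff.2 ⟨c, ?_⟩
    rw [zsmul_eq_mul, Int.cast_id, mul_comm]
    exact (mul_left_cancel₀ hC0 hc).symm
  have habs := congrArg Int.natAbs hc₁
  simp only [Int.natAbs_mul, Int.natAbs_natCast] at habs
  -- `habs : (j!·d₁⋯d_j) · r = (j+1)!·d₁⋯d_{j+1}` with `r = |B(θ, y₁)|` the index
  rw [hrange, Int.index_zmultiples]
  refine ⟨?_, by rw [mul_comm]; exact habs⟩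
  rw [prod_castLE_succ_eq₉₇ d hle, Nat.factorial_succ] at habs
  have hpos : 0 < j.factorial * ∏ i : Fin j, d (Fin.castLE hle i) := Nat.mul_pos (Nat.factorial_pos j) (Finset.prod_pos fun i _ ↦ hd.pos hη _)
  refine Nat.eq_of_mul_eq_mul_left hpos ?_
  rw [habs]
  ring

end ValueGroup

/-! ## §2 `[NS(X) : ℤθ ⊕ θ^⊥] · [B₂(θ, H²(X, ℤ)) : B_N(θ, NS(X))] = g · d_g` -/

section NeronSeveri

variable {ι : Type*} [Fintype ι] [DecidableEq ι] {E : Type*} [NormedAddCommGroup E] [NormedSpace ℂ E]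
  {Φ : (ι → ℝ) ≃L[ℝ] E} {j n : ℕ} {η : E [⋀^Fin 2]→L[ℝ] ℝ} {d : Fin (j + 2) → ℕ}

omit [Fintype ι] in
/-- **`B_N(θ, NS(X)) ⊆ B₂(θ, H²(X, ℤ))`**: the `θ`-degrees of divisor classes are `θ`-degrees of integral `2`-classes (`NS(X) ⊆ H²(X, ℤ)` and both forms are
`⟨·, γ ∧ ·⟩_e`). [cite: Lange2023AbelianVarietiesComplex, §1.3.1 Lemma 1.3.1; §6.2.4 (PDF p. 310)] -/
theorem range_neronSeveri_le_range_of_eq_poincarePairing_wedge {γ : E [⋀^Fin (2 * j)]→L[ℝ] ℂ} (e : Fin n ≃ ι) (hn : 2 + (2 * j + 2) = n)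
    {B : BilinForm ℤ ↥(integralForms Φ 2)}
    (hB : ∀ x y : ↥(integralForms Φ 2), ((B x y : ℤ) : ℂ) = poincarePairing Φ e hn (x : E [⋀^Fin 2]→L[ℝ] ℂ) (γ.wedge (y : E [⋀^Fin 2]→L[ℝ] ℂ)))
    {BN : BilinForm ℤ (neronSeveriGroup Φ)}
    (hBN : ∀ D D' : neronSeveriGroup Φ, ((BN D D' : ℤ) : ℂ) =
      poincarePairing Φ e hn (ofRealForm (D : E [⋀^Fin 2]→L[ℝ] ℝ)) (γ.wedge (ofRealForm (D' : E [⋀^Fin 2]→L[ℝ] ℝ))))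
    (θ : neronSeveriGroup Φ) (θZ : ↥(integralForms Φ 2)) (hθZ : (θZ : E [⋀^Fin 2]→L[ℝ] ℂ) = ofRealForm (θ : E [⋀^Fin 2]→L[ℝ] ℝ)) :
    (LinearMap.range (BN θ)).toAddSubgroup ≤ (LinearMap.range (B θZ)).toAddSubgroup := fun z hz ↦ by
  obtain ⟨D, rfl⟩ := LinearMap.mem_range.1 ((Submodule.mem_toAddSubgroup _).1 hz)
  refine (Submodule.mem_toAddSubgroup _).2 (LinearMap.mem_range.2
    ⟨⟨ofRealForm (D : E [⋀^Fin 2]→L[ℝ] ℝ), ofRealForm_mem_integralForms_two Φ ((mem_neronSeveriGroup_iff Φ).1 D.2)⟩, ?_⟩)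
  apply Int.cast_injective (α := ℂ)
  rw [hB, hBN, hθZ]

/-- **THE INDEX OF THE LEFSCHETZ SPLITTING OF THE NÉRON–SEVERI LATTICE: `[NS(X) : ℤθ ⊕ θ^⊥] · [B₂(θ, H²(X, ℤ)) : B_N(θ, NS(X))] = g · d_g`**
(`g = j + 2`, type `(d₁, …, d_g)`; `θ^⊥ = NS(X) ∩ P²(X, ℤ) = NS(X)_prim`, g44-#1), and the relative index `n = [B₂(θ, H²(X, ℤ)) : B_N(θ, NS(X))]` is positive:
`[NS : ℤθ ⊕ θ^⊥]·[ℤ : B_N(θ, NS)] = |B_N(θ, θ)| = g(g−1)·d_{g−1}·d_g` (the line formula) and `[ℤ : B_N(θ, NS)] = n·(g−1)·d_{g−1}` (§1).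
[cite: Lange2023AbelianVarietiesComplex, §5.4.1 Thm. 5.4.2 and (5.22)–(5.23) (PDF p. 275); §5.2 Thm. 5.2.4 (PDF p. 262); §1.7.2 Lemma 1.7.5 (PDF p. 73)] [cite: Huybrechts2016K3, Ch. 14 §0.1–§0.2] [cite: Hartshorne1977, Ch. V Thm. 1.9, Rem. 1.9.1] -/
theorem IsPolarizationType.index_span_sup_orthogonal_neronSeveri_mul_relIndex_eq (hd : IsPolarizationType Φ η d) (hη : IsRiemannForm Φ η)
    (hle : j ≤ j + 2) {γ : E [⋀^Fin (2 * j)]→L[ℝ] ℂ} (hγ : wedgePow (ofRealForm η) j = ((j.factorial * ∏ i : Fin j, d (Fin.castLE hle i) : ℕ) : ℂ) • γ)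
    (e : Fin n ≃ ι) (hn : 2 + (2 * j + 2) = n) {B : BilinForm ℤ ↥(integralForms Φ 2)}
    (hB : ∀ x y : ↥(integralForms Φ 2), ((B x y : ℤ) : ℂ) = poincarePairing Φ e hn (x : E [⋀^Fin 2]→L[ℝ] ℂ) (γ.wedge (y : E [⋀^Fin 2]→L[ℝ] ℂ)))
    {BN : BilinForm ℤ (neronSeveriGroup Φ)}
    (hBN : ∀ D D' : neronSeveriGroup Φ, ((BN D D' : ℤ) : ℂ) =
      poincarePairing Φ e hn (ofRealForm (D : E [⋀^Fin 2]→L[ℝ] ℝ)) (γ.wedge (ofRealForm (D' : E [⋀^Fin 2]→L[ℝ] ℝ))))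
    {θ : neronSeveriGroup Φ} (hθ : (θ : E [⋀^Fin 2]→L[ℝ] ℝ) = η) (θZ : ↥(integralForms Φ 2)) (hθZ : (θZ : E [⋀^Fin 2]→L[ℝ] ℂ) = ofRealForm η) :
    ((ℤ ∙ θ) ⊔ BN.orthogonal (ℤ ∙ θ)).toAddSubgroup.index *
        (LinearMap.range (BN θ)).toAddSubgroup.relIndex (LinearMap.range (B θZ)).toAddSubgroup = (j + 2) * d (Fin.last (j + 1)) ∧
      0 < (LinearMap.range (BN θ)).toAddSubgroup.relIndex (LinearMap.range (B θZ)).toAddSubgroup ∧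
      (LinearMap.range (BN θ)).toAddSubgroup.index =
        (LinearMap.range (BN θ)).toAddSubgroup.relIndex (LinearMap.range (B θZ)).toAddSubgroup * ((j + 1) * d (Fin.last j).castSucc) := by
  -- the line formula `J · [ℤ : B_N(θ, NS)] = |B_N(θ, θ)| = (j+2)(j+1) d_j d_{j+1}`
  have hline := index_line_sup_orthogonal_mul_index_range_eq_natAbs BN θ (ℤ ∙ θ) fun x ↦ Submodule.mem_span_singleton
  rw [(hd.natAbs_apply_self_neronSeveri_of_eq_poincarePairing_wedge hη hle hγ e hn hBN hθ).2] at hline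
  -- `[ℤ : B_N(θ, NS)] = n · [ℤ : B₂(θ, H²)] = n · (j+1) d_j`
  have hle' := range_neronSeveri_le_range_of_eq_poincarePairing_wedge e hn hB hBN θ θZ (hθZ.trans (by rw [hθ]))
  have hm := (AddSubgroup.relIndex_mul_index hle').symm
  rw [(hd.index_range_apply_polarization_eq hη hle hγ e hn hB θZ hθZ).1] at hm
  have hpos : 0 < (j + 1) * d (Fin.last j).castSucc := Nat.mul_pos (Nat.succ_pos j) (hd.pos hη _)
  refine ⟨?_, Nat.pos_of_ne_zero fun h0 ↦ ?_, hm⟩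
  · refine Nat.eq_of_mul_eq_mul_right hpos ?_
    calc ((ℤ ∙ θ) ⊔ BN.orthogonal (ℤ ∙ θ)).toAddSubgroup.index *
          (LinearMap.range (BN θ)).toAddSubgroup.relIndex (LinearMap.range (B θZ)).toAddSubgroup * ((j + 1) * d (Fin.last j).castSucc)
        = ((ℤ ∙ θ) ⊔ BN.orthogonal (ℤ ∙ θ)).toAddSubgroup.index * (LinearMap.range (BN θ)).toAddSubgroup.index := by rw [hm, mul_assoc]
      _ = (j + 2) * (j + 1) * d (Fin.last j).castSucc * d (Fin.last (j + 1)) := hline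
      _ = (j + 2) * d (Fin.last (j + 1)) * ((j + 1) * d (Fin.last j).castSucc) := by ring
  · rw [h0, zero_mul] at hm
    have h3 := (index_line_sup_orthogonal_pos BN θ (ℤ ∙ θ) (fun x ↦ Submodule.mem_span_singleton)
      (hd.natAbs_apply_self_neronSeveri_of_eq_poincarePairing_wedge hη hle hγ e hn hBN hθ).1).2
    exact h3.ne' hm

/-- **COROLLARIES: `[NS(X) : ℤθ ⊕ θ^⊥] ∣ g·d_g`, and `[NS(X) : ℤθ ⊕ θ^⊥] = g·d_g` iff `B_N(θ, NS(X)) = B₂(θ, H²(X, ℤ))`** (every `θ`-degree of an integral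
`2`-class is the `θ`-degree of a divisor class — as for `H²(X, ℤ) ⊇ ℤθ ⊕ P²(X, ℤ)` itself, index `g·d_g`, g40).
[cite: Lange2023AbelianVarietiesComplex, §5.4.1 (5.22)–(5.23) (PDF p. 275); §5.2 Thm. 5.2.4 (PDF p. 262)] [cite: Huybrechts2016K3, Ch. 14 §0.1–§0.2] -/
theorem IsPolarizationType.index_span_sup_orthogonal_neronSeveri_dvd (hd : IsPolarizationType Φ η d) (hη : IsRiemannForm Φ η)
    (hle : j ≤ j + 2) {γ : E [⋀^Fin (2 * j)]→L[ℝ] ℂ} (hγ : wedgePow (ofRealForm η) j = ((j.factorial * ∏ i : Fin j, d (Fin.castLE hle i) : ℕ) : ℂ) • γ)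
    (e : Fin n ≃ ι) (hn : 2 + (2 * j + 2) = n) {B : BilinForm ℤ ↥(integralForms Φ 2)}
    (hB : ∀ x y : ↥(integralForms Φ 2), ((B x y : ℤ) : ℂ) = poincarePairing Φ e hn (x : E [⋀^Fin 2]→L[ℝ] ℂ) (γ.wedge (y : E [⋀^Fin 2]→L[ℝ] ℂ)))
    {BN : BilinForm ℤ (neronSeveriGroup Φ)}
    (hBN : ∀ D D' : neronSeveriGroup Φ, ((BN D D' : ℤ) : ℂ) =
      poincarePairing Φ e hn (ofRealForm (D : E [⋀^Fin 2]→L[ℝ] ℝ)) (γ.wedge (ofRealForm (D' : E [⋀^Fin 2]→L[ℝ] ℝ))))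
    {θ : neronSeveriGroup Φ} (hθ : (θ : E [⋀^Fin 2]→L[ℝ] ℝ) = η) (θZ : ↥(integralForms Φ 2)) (hθZ : (θZ : E [⋀^Fin 2]→L[ℝ] ℂ) = ofRealForm η) :
    ((ℤ ∙ θ) ⊔ BN.orthogonal (ℤ ∙ θ)).toAddSubgroup.index ∣ (j + 2) * d (Fin.last (j + 1)) ∧
      (((ℤ ∙ θ) ⊔ BN.orthogonal (ℤ ∙ θ)).toAddSubgroup.index = (j + 2) * d (Fin.last (j + 1)) ↔
        (LinearMap.range (BN θ)).toAddSubgroup.relIndex (LinearMap.range (B θZ)).toAddSubgroup = 1) := by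
  obtain ⟨h, hn0, -⟩ := hd.index_span_sup_orthogonal_neronSeveri_mul_relIndex_eq hη hle hγ e hn hB hBN hθ θZ hθZ
  have hgd : 0 < (j + 2) * d (Fin.last (j + 1)) := Nat.mul_pos (Nat.succ_pos _) (hd.pos hη _)
  refine ⟨Dvd.intro _ h, fun hJ ↦ ?_, fun h1 ↦ by rw [h1, mul_one] at h; exact h⟩
  rw [hJ] at h
  exact (Nat.eq_of_mul_eq_mul_left hgd (h.trans (mul_one _).symm))

/-- **Principal polarisation: `[NS(X) : ℤθ ⊕ NS(X)_prim] · n = g`** (`n = [B₂(θ, H²(X, ℤ)) : B_N(θ, NS(X))]`; a very general p.p.a.v. has `NS(X) = ℤθ`, index `1` and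
`n = g`; for `E × E'` with the product principal polarisation the index is `2 = g` and `n = 1`). [cite: Lange2023AbelianVarietiesComplex, §5.4.1 (5.22)–(5.23) (PDF p. 275); §5.2 Thm. 5.2.4 (PDF p. 262)] [cite: Hartshorne1977, Ch. V Thm. 1.9, Rem. 1.9.1] -/
theorem IsPolarizationType.index_span_sup_orthogonal_neronSeveri_mul_relIndex_eq_of_forall_eq_one (hd : IsPolarizationType Φ η d)
    (hη : IsRiemannForm Φ η) (h1 : ∀ i, d i = 1)
    (hle : j ≤ j + 2) {γ : E [⋀^Fin (2 * j)]→L[ℝ] ℂ} (hγ : wedgePow (ofRealForm η) j = ((j.factorial * ∏ i : Fin j, d (Fin.castLE hle i) : ℕ) : ℂ) • γ)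
    (e : Fin n ≃ ι) (hn : 2 + (2 * j + 2) = n) {B : BilinForm ℤ ↥(integralForms Φ 2)}
    (hB : ∀ x y : ↥(integralForms Φ 2), ((B x y : ℤ) : ℂ) = poincarePairing Φ e hn (x : E [⋀^Fin 2]→L[ℝ] ℂ) (γ.wedge (y : E [⋀^Fin 2]→L[ℝ] ℂ)))
    {BN : BilinForm ℤ (neronSeveriGroup Φ)}
    (hBN : ∀ D D' : neronSeveriGroup Φ, ((BN D D' : ℤ) : ℂ) =
      poincarePairing Φ e hn (ofRealForm (D : E [⋀^Fin 2]→L[ℝ] ℝ)) (γ.wedge (ofRealForm (D' : E [⋀^Fin 2]→L[ℝ] ℝ))))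
    {θ : neronSeveriGroup Φ} (hθ : (θ : E [⋀^Fin 2]→L[ℝ] ℝ) = η) (θZ : ↥(integralForms Φ 2)) (hθZ : (θZ : E [⋀^Fin 2]→L[ℝ] ℂ) = ofRealForm η) :
    ((ℤ ∙ θ) ⊔ BN.orthogonal (ℤ ∙ θ)).toAddSubgroup.index *
        (LinearMap.range (BN θ)).toAddSubgroup.relIndex (LinearMap.range (B θZ)).toAddSubgroup = j + 2 := by
  have h := (hd.index_span_sup_orthogonal_neronSeveri_mul_relIndex_eq hη hle hγ e hn hB hBN hθ θZ hθZ).1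
  rw [h1, mul_one] at h
  exact h

/-- **THE INDEX FORMULA, DATA-FREE**: for the polarisation `θ ∈ NS(X)` of a polarised abelian variety of dimension `g = j + 2` and type `(d₁, …, d_g)` there are the
symmetric Néron–Severi lattice form `B_N = ⟨·, γ_{g−2} ∧ ·⟩_e` on `NS(X)`, the integral Lefschetz form `B₂` of `H²(X, ℤ)` and `θ ∈ H²(X, ℤ)` with
`[ℤ : B₂(θ, H²(X, ℤ))] = (g−1)·d_{g−1}`, `ℤθ ∩ θ^⊥ = 0`, and **`[NS(X) : ℤθ ⊕ θ^⊥] · [B₂(θ, H²(X, ℤ)) : B_N(θ, NS(X))] = g·d_g`** with both factors positive.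
[cite: Lange2023AbelianVarietiesComplex, §5.4.1 Thm. 5.4.2 and (5.22)–(5.23) (PDF p. 275); §5.2 Thm. 5.2.4 (PDF p. 262); §2.5.3 Thm. 2.5.16 (PDF p. 135)] [cite: Huybrechts2016K3, Ch. 14 §0.1–§0.2] [cite: Hartshorne1977, Ch. V Thm. 1.9, Rem. 1.9.1] -/
theorem IsPolarizationType.exists_index_span_sup_orthogonal_neronSeveri_mul_relIndex_eq (hd : IsPolarizationType Φ η d) (hη : IsRiemannForm Φ η)
    {θ : neronSeveriGroup Φ} (hθ : (θ : E [⋀^Fin 2]→L[ℝ] ℝ) = η) :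
    ∃ (BN : BilinForm ℤ (neronSeveriGroup Φ)) (B : BilinForm ℤ ↥(integralForms Φ 2)) (θZ : ↥(integralForms Φ 2)),
      BN.IsSymm ∧ (θZ : E [⋀^Fin 2]→L[ℝ] ℂ) = ofRealForm η ∧
      (LinearMap.range (B θZ)).toAddSubgroup.index = (j + 1) * d (Fin.last j).castSucc ∧
      (ℤ ∙ θ) ⊓ BN.orthogonal (ℤ ∙ θ) = ⊥ ∧
      ((ℤ ∙ θ) ⊔ BN.orthogonal (ℤ ∙ θ)).toAddSubgroup.index *
          (LinearMap.range (BN θ)).toAddSubgroup.relIndex (LinearMap.range (B θZ)).toAddSubgroup = (j + 2) * d (Fin.last (j + 1)) ∧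
      0 < ((ℤ ∙ θ) ⊔ BN.orthogonal (ℤ ∙ θ)).toAddSubgroup.index ∧
      0 < (LinearMap.range (BN θ)).toAddSubgroup.relIndex (LinearMap.range (B θZ)).toAddSubgroup := by
  have hle : j ≤ j + 2 := Nat.le_add_right j 2
  obtain ⟨γ, hγZ, hγ⟩ := hd.exists_mem_integralForms_wedgePow_eq_content_smul hle
  have hcard : Fintype.card ι = 2 + (2 * j + 2) := by rw [hd.card_eq]; omega
  let e : Fin (2 + (2 * j + 2)) ≃ ι := (Fintype.equivFinOfCardEq hcard).symm
  obtain ⟨BN, hBN⟩ := exists_bilinForm_neronSeveriGroup_eq_poincarePairing_wedge Φ hγZ e rfl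
  obtain ⟨B, hB⟩ := exists_bilinForm_eq_poincarePairing_wedge Φ hγZ e rfl
  have hθZ' : ofRealForm η ∈ integralForms Φ 2 := by
    rw [← hθ]
    exact ofRealForm_mem_integralForms_two Φ ((mem_neronSeveriGroup_iff Φ).1 θ.2)
  have hmain := hd.index_span_sup_orthogonal_neronSeveri_mul_relIndex_eq hη hle hγ e rfl hB hBN hθ ⟨ofRealForm η, hθZ'⟩ rfl
  have hspl := hd.index_span_sup_orthogonal_neronSeveri_dvd_of_eq_poincarePairing_wedge hη hle hγ e rfl hBN hθ
  exact ⟨BN, B, ⟨ofRealForm η, hθZ'⟩, isSymm_neronSeveri_of_eq_poincarePairing_wedge e rfl hBN, rfl,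
    (hd.index_range_apply_polarization_eq hη hle hγ e rfl hB ⟨ofRealForm η, hθZ'⟩ rfl).1, hspl.1, hmain.1, hspl.2.2, hmain.2.1⟩

end NeronSeveri

/-! ## §3 The discriminant of the primitive Néron–Severi lattice: `±(g−1)·d_{g−1}·n²·disc(NS(X)_prim) = g·d_g·disc(NS(X))` -/

section Discriminant

variable {ι : Type*} [Fintype ι] [DecidableEq ι] {E : Type*} [NormedAddCommGroup E] [NormedSpace ℂ E]
  {Φ : (ι → ℝ) ≃L[ℝ] E} {j n : ℕ} {η : E [⋀^Fin 2]→L[ℝ] ℝ} {d : Fin (j + 2) → ℕ}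

/-- **THE DISCRIMINANT OF THE PRIMITIVE NÉRON–SEVERI LATTICE: `sign(e)·(−1)^g·(g−1)·d_{g−1} · n² · disc(θ^⊥) = g·d_g · disc(NS(X))`** in any `ℤ`-bases `b` of
`NS(X)` and `c` of `θ^⊥ = NS(X)_prim` (`n = [B₂(θ, H²(X, ℤ)) : B_N(θ, NS(X))]`): Huybrechts' `B_N(θ, θ)·disc(θ^⊥) = [NS : ℤθ ⊕ θ^⊥]²·disc NS` (g44-#1) with
`B_N(θ, θ) = ±g(g−1)d_{g−1}d_g` and §2's `[NS : ℤθ ⊕ θ^⊥]·n = g·d_g`. For a principal polarisation `±(g−1)·n²·disc(NS(X)_prim) = g·disc(NS(X))`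
(very general p.p.a.v.: `disc NS = ±g(g−1)`, `NS_prim = 0`, `n = g`; `E × E'`: `disc NS = −1`, `disc NS_prim = ∓2`, `n = 1`, `g = 2`).
[cite: Huybrechts2016K3, Ch. 14 §0.1 (0.2), §0.2] [cite: Hartshorne1977, Ch. V Thm. 1.9, Rem. 1.9.1] [cite: Lange2023AbelianVarietiesComplex, §5.2 Thm. 5.2.4 (PDF p. 262); §5.4.1 (5.22)–(5.23) (PDF p. 275)] -/
theorem IsPolarizationType.relIndex_sq_mul_det_orthogonal_neronSeveri_eq (hd : IsPolarizationType Φ η d) (hη : IsRiemannForm Φ η)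
    (hle : j ≤ j + 2) {γ : E [⋀^Fin (2 * j)]→L[ℝ] ℂ} (hγ : wedgePow (ofRealForm η) j = ((j.factorial * ∏ i : Fin j, d (Fin.castLE hle i) : ℕ) : ℂ) • γ)
    (e : Fin n ≃ ι) (hn : 2 + (2 * j + 2) = n) {B : BilinForm ℤ ↥(integralForms Φ 2)}
    (hB : ∀ x y : ↥(integralForms Φ 2), ((B x y : ℤ) : ℂ) = poincarePairing Φ e hn (x : E [⋀^Fin 2]→L[ℝ] ℂ) (γ.wedge (y : E [⋀^Fin 2]→L[ℝ] ℂ)))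
    {BN : BilinForm ℤ (neronSeveriGroup Φ)}
    (hBN : ∀ D D' : neronSeveriGroup Φ, ((BN D D' : ℤ) : ℂ) =
      poincarePairing Φ e hn (ofRealForm (D : E [⋀^Fin 2]→L[ℝ] ℝ)) (γ.wedge (ofRealForm (D' : E [⋀^Fin 2]→L[ℝ] ℝ))))
    {θ : neronSeveriGroup Φ} (hθ : (θ : E [⋀^Fin 2]→L[ℝ] ℝ) = η) (θZ : ↥(integralForms Φ 2)) (hθZ : (θZ : E [⋀^Fin 2]→L[ℝ] ℂ) = ofRealForm η)
    {κ κ' : Type*} [Fintype κ] [DecidableEq κ] [Fintype κ'] [DecidableEq κ'] (b : Basis κ ℤ (neronSeveriGroup Φ)) (c : Basis κ' ℤ ↥(BN.orthogonal (ℤ ∙ θ))) :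
    (orientationSign Φ e * (-1) ^ j * (((j + 1) * d (Fin.last j).castSucc : ℕ) : ℤ)) *
          ((LinearMap.range (BN θ)).toAddSubgroup.relIndex (LinearMap.range (B θZ)).toAddSubgroup : ℤ) ^ 2 *
        (LinearMap.BilinForm.toMatrix c (BN.restrict (BN.orthogonal (ℤ ∙ θ)))).det =
      (((j + 2) * d (Fin.last (j + 1)) : ℕ) : ℤ) * (LinearMap.BilinForm.toMatrix b BN).det := by
  have h44 := (hd.apply_self_mul_det_orthogonal_neronSeveri_of_eq_poincarePairing_wedge hη hle hγ e hn hBN hθ b c).1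
  have hJn := (hd.index_span_sup_orthogonal_neronSeveri_mul_relIndex_eq hη hle hγ e hn hB hBN hθ θZ hθZ).1
  have hJn' : (((ℤ ∙ θ) ⊔ BN.orthogonal (ℤ ∙ θ)).toAddSubgroup.index : ℤ) *
      ((LinearMap.range (BN θ)).toAddSubgroup.relIndex (LinearMap.range (B θZ)).toAddSubgroup : ℤ) = (((j + 2) * d (Fin.last (j + 1)) : ℕ) : ℤ) := by
    exact_mod_cast hJn
  have hgd : ((((j + 2) * d (Fin.last (j + 1)) : ℕ)) : ℤ) ≠ 0 := by exact_mod_cast (Nat.mul_pos (Nat.succ_pos _) (hd.pos hη _)).ne'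
  refine mul_left_cancel₀ hgd ?_
  push_cast at h44 hJn' ⊢
  linear_combination (((LinearMap.range (BN θ)).toAddSubgroup.relIndex (LinearMap.range (B θZ)).toAddSubgroup : ℤ)) ^ 2 * h44 +
    (LinearMap.BilinForm.toMatrix b BN).det * ((((ℤ ∙ θ) ⊔ BN.orthogonal (ℤ ∙ θ)).toAddSubgroup.index : ℤ) *
      ((LinearMap.range (BN θ)).toAddSubgroup.relIndex (LinearMap.range (B θZ)).toAddSubgroup : ℤ) + ((j + 2 : ℤ) * d (Fin.last (j + 1)))) * hJn'

/-- **`|disc NS(X)_prim| · (g−1)·d_{g−1}·n² = |disc NS(X)| · g·d_g`** (absolute values; `disc NS(X)_prim ≠ 0`). [cite: Huybrechts2016K3, Ch. 14 §0.1 (0.2), §0.2] [cite: Hartshorne1977, Ch. V Rem. 1.9.1] -/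
theorem IsPolarizationType.natAbs_det_orthogonal_neronSeveri_mul_eq (hd : IsPolarizationType Φ η d) (hη : IsRiemannForm Φ η)
    (hle : j ≤ j + 2) {γ : E [⋀^Fin (2 * j)]→L[ℝ] ℂ} (hγ : wedgePow (ofRealForm η) j = ((j.factorial * ∏ i : Fin j, d (Fin.castLE hle i) : ℕ) : ℂ) • γ)
    (e : Fin n ≃ ι) (hn : 2 + (2 * j + 2) = n) {B : BilinForm ℤ ↥(integralForms Φ 2)}
    (hB : ∀ x y : ↥(integralForms Φ 2), ((B x y : ℤ) : ℂ) = poincarePairing Φ e hn (x : E [⋀^Fin 2]→L[ℝ] ℂ) (γ.wedge (y : E [⋀^Fin 2]→L[ℝ] ℂ)))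
    {BN : BilinForm ℤ (neronSeveriGroup Φ)}
    (hBN : ∀ D D' : neronSeveriGroup Φ, ((BN D D' : ℤ) : ℂ) =
      poincarePairing Φ e hn (ofRealForm (D : E [⋀^Fin 2]→L[ℝ] ℝ)) (γ.wedge (ofRealForm (D' : E [⋀^Fin 2]→L[ℝ] ℝ))))
    {θ : neronSeveriGroup Φ} (hθ : (θ : E [⋀^Fin 2]→L[ℝ] ℝ) = η) (θZ : ↥(integralForms Φ 2)) (hθZ : (θZ : E [⋀^Fin 2]→L[ℝ] ℂ) = ofRealForm η)
    {κ κ' : Type*} [Fintype κ] [DecidableEq κ] [Fintype κ'] [DecidableEq κ'] (b : Basis κ ℤ (neronSeveriGroup Φ)) (c : Basis κ' ℤ ↥(BN.orthogonal (ℤ ∙ θ))) :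
    (LinearMap.BilinForm.toMatrix c (BN.restrict (BN.orthogonal (ℤ ∙ θ)))).det.natAbs * ((j + 1) * d (Fin.last j).castSucc) *
        (LinearMap.range (BN θ)).toAddSubgroup.relIndex (LinearMap.range (B θZ)).toAddSubgroup ^ 2 =
      (LinearMap.BilinForm.toMatrix b BN).det.natAbs * ((j + 2) * d (Fin.last (j + 1))) ∧
    (LinearMap.BilinForm.toMatrix c (BN.restrict (BN.orthogonal (ℤ ∙ θ)))).det ≠ 0 := by
  have h := congrArg Int.natAbs (hd.relIndex_sq_mul_det_orthogonal_neronSeveri_eq hη hle hγ e hn hB hBN hθ θZ hθZ b c)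
  have hs : (orientationSign Φ e).natAbs = 1 := by
    have h1 := congrArg Int.natAbs (orientationSign_mul_self Φ e)
    rw [Int.natAbs_mul, Int.natAbs_one] at h1
    exact Nat.eq_one_of_mul_eq_one_left h1
  simp only [Int.natAbs_mul, Int.natAbs_pow, Int.natAbs_neg, Int.natAbs_one, one_pow, one_mul, mul_one, Int.natAbs_natCast, hs] at h
  rw [mul_right_comm, mul_comm ((j + 1) * d (Fin.last j).castSucc)] at h
  exact ⟨h.trans (mul_comm _ _), (hd.apply_self_mul_det_orthogonal_neronSeveri_of_eq_poincarePairing_wedge hη hle hγ e hn hBN hθ b c).2⟩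

end Discriminant

end Literature.Geometry.Kaehler.ComplexTorus

end
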